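import Mathlib
import Literature.Analysis.FluidPDE.Tao2016AveragedNS.BoundedEternalSolutions
import Summits.NavierStokesRegularity.NavierStokesRegularity.Theses.TaoLadderRungTwoBreak

/-!
# Crux `TaoLadderRungTwoBreak.NoSurvivingEternalViscBddOne` (stmt-NavierStokesRegularity-20419), stub (ρ0), DYADIC MEMBER in
# classical form: the LIFETIME FEED–DRAIN IDENTITY `v_n = Λ ∫ V_{n-1}² − Λ⁻¹ ∫ V_n V_{n+1}`

MODEL lattice ODEs only (the non-negative Katz–Pavlović / Desnianskii–Novikov chain in Tao's critical variables,
`V̇_n = Λ V_{n-1}² − Λ⁻¹ V_n V_{n+1}` on `t < 0`, `Λ = (1+ε₀)^{5/2}`; tree `…WakeDyadicClassical`); nothing in this file is a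
statement about the Navier–Stokes equations, and no stub, crux, rung or summit is proved by it
(`--supports stmt-NavierStokesRegularity-20419`).  DEF-FREE; companion of `…WakeDyadicQuasiStaticBalance` and
`…WakeDyadicDSSTerminalDrift`.

* `integral_drive_eq_terminal_sub` — FTC with the one-sided terminal value: for `a < 0`,
  `∫_a^0 (ΛV_{n-1}² − Λ⁻¹V_nV_{n+1}) = v_n − V_n(a)` (`V_n → v_n` as `t ↑ 0`).
* `terminal_eq_integral_drive` / `terminal_eq_feed_sub_drain` — **LIFETIME FEED–DRAIN IDENTITY**: for a shell born at rest
  (`V_n → 0` as `t → −∞`, automatic for admissible eternal solutions) with integrable lifetime feed `V_{n-1}²` and drain `V_nV_{n+1}`: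
  `v_n = Λ∫_{(−∞,0)} V_{n-1}² − Λ⁻¹∫_{(−∞,0)} V_nV_{n+1}` (improper integral as the limit of the windows `[a, 0]`, `a → −∞`);
  with signs, `v_n ≤ Λ∫V_{n-1}²` (`terminal_le_feed`, the integral form behind the tree's `v_{n+1} ≤ ΛMe^{M/Λ}v_n`) and
  `Λ⁻¹∫V_nV_{n+1} ≤ Λ∫V_{n-1}²` (`drain_le_feed`).
  On a DSS front with profile `ψ` (`V_n(t) = κⁿψ(κⁿ|t|)`, `…DSSTerminalDrift`) this is the exact profile identity
  `(I1)  ψ(0) = (Λ/κ)∫₀^∞ψ² − (κ/Λ)∫₀^∞ψ(u)ψ(κu)du`, the first of the two identities ((I2) = energy–flux) whose leading-order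
  evaluation in `log Λ` (memo `W1-DSS-identities-memo-leafhand4-g24.md` on ⟨20419⟩/⟨20205⟩) puts a flat stranded wake at
  `κ = Λ^{2/3}` (K41; front top `log Λ · sup w → 3/4`) and a maximally diffuse one exactly at the (S₁) threshold `κ = Λ^{4/5}`.

HONEST LABEL: elementary real analysis (FTC with one-sided limits, improper integrals as limits of window integrals); W1-dyadic,
(ρ0), ⟨20419⟩, ⟨20205⟩ and every NS statement remain OPEN; rung 0.
-/

-- the summit and its single sub-problem share the name (CONVENTIONS §1)
set_option linter.dupNamespace false

namespace Summit.NavierStokesRegularity.NavierStokesRegularity.Theorems.NoSurvivingEternalViscBddOne.LifetimeFeedDrain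

open Filter Topology Set MeasureTheory
open Literature.Analysis.FluidPDE.TaoCascade

variable {ε₀ : ℝ} {V : ℤ → ℝ → ℝ}

/-! ## §4 The lifetime feed–drain identity -/

/-- **FTC with the terminal value.**  For `a < 0`: if shell `n` has terminal value `v_n` (`t ↑ 0`) and its drive is interval-integrable
on `[a, 0]`, then `∫_a^0 (ΛV_{n-1}² − Λ⁻¹V_nV_{n+1}) = v_n − V_n(a)`.
[cite: Tao2016AveragedNS, §1.2, §4 Lemma 4.1 (4.8), §6.4; elementary] -/
theorem integral_drive_eq_terminal_sub
    (hV : ∀ (n : ℤ) (t : ℝ), t < 0 →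
      HasDerivAt (V n) (bigLam ε₀ * V (n - 1) t ^ 2 - (bigLam ε₀)⁻¹ * (V n t * V (n + 1) t)) t)
    {v : ℤ → ℝ} (hv : ∀ n : ℤ, Tendsto (V n) (𝓝[<] 0) (𝓝 (v n))) (n : ℤ) {a : ℝ} (ha : a < 0)
    (hint : IntervalIntegrable (fun t => bigLam ε₀ * V (n - 1) t ^ 2 - (bigLam ε₀)⁻¹ * (V n t * V (n + 1) t)) volume a 0) :
    ∫ t in a..0, (bigLam ε₀ * V (n - 1) t ^ 2 - (bigLam ε₀)⁻¹ * (V n t * V (n + 1) t)) = v n - V n a := by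
  have hcont : Tendsto (V n) (𝓝[>] a) (𝓝 (V n a)) :=
    ((hV n a ha).continuousAt.tendsto).mono_left nhdsWithin_le_nhds
  exact intervalIntegral.integral_eq_sub_of_hasDerivAt_of_tendsto ha (fun t ht => hV n t ht.2) hint hcont (hv n)

/-- **LIFETIME DRIVE IDENTITY.**  If shell `n` is born at rest (`V_n → 0` as `t → −∞`), has terminal value `v_n`, and its drive is
integrable on `(−∞, 0]`, then `v_n = ∫_{(−∞,0)} (ΛV_{n-1}² − Λ⁻¹V_nV_{n+1})`.
[cite: Tao2016AveragedNS, §1.2, §4 Lemma 4.1 (4.8), §6.4; elementary] -/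
theorem terminal_eq_integral_drive
    (hV : ∀ (n : ℤ) (t : ℝ), t < 0 →
      HasDerivAt (V n) (bigLam ε₀ * V (n - 1) t ^ 2 - (bigLam ε₀)⁻¹ * (V n t * V (n + 1) t)) t)
    {v : ℤ → ℝ} (hv : ∀ n : ℤ, Tendsto (V n) (𝓝[<] 0) (𝓝 (v n))) (n : ℤ)
    (hpast : Tendsto (V n) atBot (𝓝 0))
    (hint : IntegrableOn (fun t => bigLam ε₀ * V (n - 1) t ^ 2 - (bigLam ε₀)⁻¹ * (V n t * V (n + 1) t)) (Iic 0)) :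
    v n = ∫ t in Iio 0, (bigLam ε₀ * V (n - 1) t ^ 2 - (bigLam ε₀)⁻¹ * (V n t * V (n + 1) t)) := by
  set D : ℝ → ℝ := fun t => bigLam ε₀ * V (n - 1) t ^ 2 - (bigLam ε₀)⁻¹ * (V n t * V (n + 1) t) with hD
  -- the window integrals converge to the improper integral …
  have hlim1 : Tendsto (fun a : ℝ => ∫ t in a..0, D t) atBot (𝓝 (∫ t in Iic 0, D t)) :=
    MeasureTheory.intervalIntegral_tendsto_integral_Iic 0 hint tendsto_id
  -- … and equal `v_n − V_n(a)` for `a < 0`, which converges to `v_n`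
  have hlim2 : Tendsto (fun a : ℝ => ∫ t in a..0, D t) atBot (𝓝 (v n - 0)) := by
    have h : Tendsto (fun a : ℝ => v n - V n a) atBot (𝓝 (v n - 0)) := tendsto_const_nhds.sub hpast
    refine h.congr' ?_
    filter_upwards [eventually_lt_atBot (0 : ℝ)] with a ha
    have hsub : uIcc a 0 ⊆ Iic 0 := by
      rw [uIcc_of_le ha.le]; exact Icc_subset_Iic_self
    exact (integral_drive_eq_terminal_sub hV hv n ha ((hint.mono_set hsub).intervalIntegrable)).symm
  have heq := tendsto_nhds_unique hlim2 hlim1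
  rw [sub_zero] at heq
  rw [heq, integral_Iic_eq_integral_Iio]

/-- **LIFETIME FEED–DRAIN IDENTITY `v_n = Λ∫V_{n-1}² − Λ⁻¹∫V_nV_{n+1}`** (integrals over `(−∞, 0)`), for a shell born at rest with
integrable lifetime feed and drain.  On a DSS front with profile `ψ` (`V_n(t) = κⁿψ(κⁿ|t|)`) this is the exact profile identity
`ψ(0) = (Λ/κ)∫ψ² − (κ/Λ)∫ψ(u)ψ(κu)du` of the hand's memo.
[cite: Tao2016AveragedNS, §1.2, §4 Lemma 4.1 (4.8), §6.4; elementary] -/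
theorem terminal_eq_feed_sub_drain
    (hV : ∀ (n : ℤ) (t : ℝ), t < 0 →
      HasDerivAt (V n) (bigLam ε₀ * V (n - 1) t ^ 2 - (bigLam ε₀)⁻¹ * (V n t * V (n + 1) t)) t)
    {v : ℤ → ℝ} (hv : ∀ n : ℤ, Tendsto (V n) (𝓝[<] 0) (𝓝 (v n))) (n : ℤ)
    (hpast : Tendsto (V n) atBot (𝓝 0))
    (hfeed : IntegrableOn (fun t => V (n - 1) t ^ 2) (Iic 0))
    (hdrain : IntegrableOn (fun t => V n t * V (n + 1) t) (Iic 0)) :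
    v n = bigLam ε₀ * (∫ t in Iio 0, V (n - 1) t ^ 2) - (bigLam ε₀)⁻¹ * (∫ t in Iio 0, V n t * V (n + 1) t) := by
  have hint : IntegrableOn
      (fun t => bigLam ε₀ * V (n - 1) t ^ 2 - (bigLam ε₀)⁻¹ * (V n t * V (n + 1) t)) (Iic 0) :=
    (hfeed.const_mul _).sub (hdrain.const_mul _)
  have h := terminal_eq_integral_drive hV hv n hpast hint
  have hfeed' : IntegrableOn (fun t => V (n - 1) t ^ 2) (Iio 0) := hfeed.mono_set Iio_subset_Iic_self
  have hdrain' : IntegrableOn (fun t => V n t * V (n + 1) t) (Iio 0) := hdrain.mono_set Iio_subset_Iic_self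
  rw [h, integral_sub (hfeed'.const_mul _) (hdrain'.const_mul _), integral_const_mul, integral_const_mul]

/-- **The stranded value is at most the lifetime feed**: `v_n ≤ Λ∫_{(−∞,0)}V_{n-1}²` for a non-negative solution (the drain has
a sign). [cite: Tao2016AveragedNS, §1.2, §4 (4.8); elementary] -/
theorem terminal_le_feed (hε : 0 < ε₀)
    (hV : ∀ (n : ℤ) (t : ℝ), t < 0 →
      HasDerivAt (V n) (bigLam ε₀ * V (n - 1) t ^ 2 - (bigLam ε₀)⁻¹ * (V n t * V (n + 1) t)) t)
    (hpos : ∀ (n : ℤ) (t : ℝ), t < 0 → 0 ≤ V n t)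
    {v : ℤ → ℝ} (hv : ∀ n : ℤ, Tendsto (V n) (𝓝[<] 0) (𝓝 (v n))) (n : ℤ)
    (hpast : Tendsto (V n) atBot (𝓝 0))
    (hfeed : IntegrableOn (fun t => V (n - 1) t ^ 2) (Iic 0))
    (hdrain : IntegrableOn (fun t => V n t * V (n + 1) t) (Iic 0)) :
    v n ≤ bigLam ε₀ * (∫ t in Iio 0, V (n - 1) t ^ 2) := by
  have hΛ : 0 < bigLam ε₀ := bigLam_pos (by linarith)
  rw [terminal_eq_feed_sub_drain hV hv n hpast hfeed hdrain]
  have hdr : 0 ≤ ∫ t in Iio 0, V n t * V (n + 1) t :=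
    setIntegral_nonneg measurableSet_Iio fun t ht => mul_nonneg (hpos n t ht) (hpos (n + 1) t ht)
  have : 0 ≤ (bigLam ε₀)⁻¹ * ∫ t in Iio 0, V n t * V (n + 1) t := mul_nonneg (inv_nonneg.2 hΛ.le) hdr
  linarith

/-- **The lifetime drain is at most the lifetime feed**: `Λ⁻¹∫V_nV_{n+1} ≤ Λ∫V_{n-1}²` (the stranded value is non-negative).
[cite: Tao2016AveragedNS, §1.2, §4 (4.8); elementary] -/
theorem drain_le_feed (hε : 0 < ε₀)
    (hV : ∀ (n : ℤ) (t : ℝ), t < 0 →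
      HasDerivAt (V n) (bigLam ε₀ * V (n - 1) t ^ 2 - (bigLam ε₀)⁻¹ * (V n t * V (n + 1) t)) t)
    (hpos : ∀ (n : ℤ) (t : ℝ), t < 0 → 0 ≤ V n t)
    {v : ℤ → ℝ} (hv : ∀ n : ℤ, Tendsto (V n) (𝓝[<] 0) (𝓝 (v n))) (n : ℤ)
    (hpast : Tendsto (V n) atBot (𝓝 0))
    (hfeed : IntegrableOn (fun t => V (n - 1) t ^ 2) (Iic 0))
    (hdrain : IntegrableOn (fun t => V n t * V (n + 1) t) (Iic 0)) :
    (bigLam ε₀)⁻¹ * (∫ t in Iio 0, V n t * V (n + 1) t) ≤ bigLam ε₀ * (∫ t in Iio 0, V (n - 1) t ^ 2) := by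
  have hvn : 0 ≤ v n := ge_of_tendsto (hv n) (eventually_nhdsWithin_of_forall fun t ht => hpos n t ht)
  have h := terminal_eq_feed_sub_drain hV hv n hpast hfeed hdrain
  have hε' := hε
  linarith

end Summit.NavierStokesRegularity.NavierStokesRegularity.Theorems.NoSurvivingEternalViscBddOne.LifetimeFeedDrain
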